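import Summits.CriticalPhenomena.PercolationContinuityZ3.Theorems.PercNearOneGluingNoHeavyLowerTailThreePartitionGridOrOr
import HarnessLib.Audit

/-!
# `NoHeavyLowerTail` (crux stmt-CriticalPhenomena-4575), master-family hierarchy P3 (gen 36): the TYPED matching for TWO DISJUNCTIONS WITH AN
# ARBITRARY TWIST — the move calculus in partition coordinates, the matching `ororMapT`, its decoder, and the forward spec

Support file (seat `prim-masterthm-p3`; `--supports stmt-CriticalPhenomena-4575`; memo
`run/shared/lean/prim/prim-masterthm/FROM-prim-masterthm-p3-g36-CYLINDER-SLACK.md` §9–§10).  Companion of `…ThreePartitionGridOrOr` (the untwisted case,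
`ororMap`, `typedMatchable_orOr`) and `…ThreePartitionGridMatching` (`negToks`, `posToks`, `typedEdge`, `TypedMatchable`).

THE POINT.  The untwisted matching of `…GridOrOr` moves named sets of coordinates between the three copies `x₁, x₂, x₃` (`x_a = S_a ∆ τ`).  For a
general twist `τ` such a move — `m` from copy `a` to copy `b`, legal iff `m ⊆ x_a ∖ x_b` — is realised in the partition coordinates `(S₁, S₂)` by the
SYMMETRIC DIFFERENCE of the two affected parts with `m` (`mvL`, `mvK`, `mvE`; a twisted coordinate moves the opposite way), the same formula performs the
reverse move (`mvL_mvL`, …), and the copies of the moved configuration are the expected ones (`cp_mvL`, `cp_mvK`, `cp_mvE`).  With this calculus the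
case table of `ororMap` carries over VERBATIM once its three fibre conditions are written in the copy that is tested for emptiness:
`T ⊆ x₃ ↦ x₂ ∩ T = ∅`, `T ⊆ x₂ ↦ x₁ ∩ T = ∅`, `Q ⊆ x₂ ↦ x₁ ∩ Q = ∅` (equivalent at `τ = ∅`, where the copies partition the ground set; for a
twisted fibre `x₃ = r` the set `E = τ ∖ r` lies in both `x₁` and `x₂`, the unlandable sites become `{s : s ∩ P′ = ∅, (E ∪ s) ∩ T ≠ ∅}` and the
reservation is `φ(s) = σs` or `σs ∪ (T ∩ F)` — the substituted conditions are exactly what this requires).  This file: the calculus, the token / edge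
unfoldings for a general twist (`mem_negToks_iff`, `mem_posToks_iff`, `typedEdge_iff_cp`), the maps `ororMapT` / `ororInvT`, and the forward spec
`ororMapT_spec`; the decoder round trip and `typedMatchable_orOrT : TypedMatchable τ (orFam P) (orFam Q)` are in `…GridOrOrTwistedMatching`.
EVIDENCE BEFORE FORMALISATION: the literal maps were checked against the twisted token system for all `τ, P, Q ⊆ [5]` (`14 052 425` negative tokens,
`0` failures; seat code `e18_twisted_leancheck.py`, kit job j305297 for `n ≤ 6`).
HONEST LABEL: one class (`(OR P, OR Q)`, every twist) of the OPEN conjecture `TypedGridMatching`; `GridTransport`, COMB-C3 and Sahi's `C₃` remain OPEN;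
nothing bears on the (closed) crux. [this work]
-/

noncomputable section

open Finset
open scoped symmDiff Classical

namespace Summit.CriticalPhenomena.PercolationContinuityZ3.Theorems.ThreePartition

variable {ι : Type*}

/-! ## Copies, elementwise -/

/-- Membership in copy 1. [this work] -/
theorem mem_cp₁_iff (τ : Set ι) (q : Set ι × Set ι) (c : ι) : c ∈ cp₁ τ q ↔ (c ∈ q.1 ∧ c ∉ τ ∨ c ∈ τ ∧ c ∉ q.1) := by
  unfold cp₁; rw [Set.mem_symmDiff]
/-- Membership in copy 2. [this work] -/
theorem mem_cp₂_iff (τ : Set ι) (q : Set ι × Set ι) (c : ι) : c ∈ cp₂ τ q ↔ (c ∈ q.2 ∧ c ∉ τ ∨ c ∈ τ ∧ c ∉ q.2) := by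
  unfold cp₂; rw [Set.mem_symmDiff]
/-- Membership in copy 3. [this work] -/
theorem mem_cp₃_iff (τ : Set ι) (q : Set ι × Set ι) (c : ι) :
    c ∈ cp₃ τ q ↔ ((c ∉ q.1 ∧ c ∉ q.2) ∧ c ∉ τ ∨ c ∈ τ ∧ ¬ (c ∉ q.1 ∧ c ∉ q.2)) := by
  unfold cp₃; rw [Set.mem_symmDiff, Set.mem_compl_iff, Set.mem_union, not_or]

/-- Every point lies in at least one copy. [this work] -/
theorem mem_cp_cover (τ : Set ι) (q : Set ι × Set ι) (c : ι) : c ∈ cp₁ τ q ∨ c ∈ cp₂ τ q ∨ c ∈ cp₃ τ q := by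
  rw [mem_cp₁_iff, mem_cp₂_iff, mem_cp₃_iff]; tauto

/-! ## The three elementary moves, in partition coordinates

Moving a set `m` from copy `a` to copy `b` (legal when `m ⊆ x_a ∖ x_b`) is, in the partition coordinates `(S₁, S₂)`, the symmetric difference of the
two affected parts with `m` (for a twisted point the partition coordinate moves the opposite way).  The same formula performs the reverse move. -/

/-- Move between copies 3 and 1 (landing / un-landing): `(S₁ ∆ m, S₂)`. [this work] -/
def mvL (q : Set ι × Set ι) (m : Set ι) : Set ι × Set ι := (q.1 ∆ m, q.2)
/-- Move between copies 2 and 1 (the `K`/`C` moves): `(S₁ ∆ m, S₂ ∆ m)`. [this work] -/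
def mvK (q : Set ι × Set ι) (m : Set ι) : Set ι × Set ι := (q.1 ∆ m, q.2 ∆ m)
/-- Move between copies 2 and 3 (the exit move `E`): `(S₁, S₂ ∆ m)`. [this work] -/
def mvE (q : Set ι × Set ι) (m : Set ι) : Set ι × Set ι := (q.1, q.2 ∆ m)

/-- `mvL` is an involution. [this work] -/
@[simp] theorem mvL_mvL (q : Set ι × Set ι) (m : Set ι) : mvL (mvL q m) m = q := by
  unfold mvL; simp [symmDiff_symmDiff_cancel_right]
/-- `mvK` is an involution. [this work] -/
@[simp] theorem mvK_mvK (q : Set ι × Set ι) (m : Set ι) : mvK (mvK q m) m = q := by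
  unfold mvK; simp [symmDiff_symmDiff_cancel_right]
/-- `mvE` is an involution. [this work] -/
@[simp] theorem mvE_mvE (q : Set ι × Set ι) (m : Set ι) : mvE (mvE q m) m = q := by
  unfold mvE; simp [symmDiff_symmDiff_cancel_right]

/-- **Copies after an `L`-move** of `m ⊆ x₃ ∖ x₁` from copy 3 to copy 1. [this work] -/
theorem cp_mvL (τ : Set ι) {q : Set ι × Set ι} (hq : Disjoint q.1 q.2) {m : Set ι} (hm : m ⊆ cp₃ τ q \ cp₁ τ q) :
    cp₁ τ (mvL q m) = cp₁ τ q ∪ m ∧ cp₂ τ (mvL q m) = cp₂ τ q ∧ cp₃ τ (mvL q m) = cp₃ τ q \ m ∧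
      Disjoint (mvL q m).1 (mvL q m).2 := by
  have hd : ∀ c, c ∈ q.1 → c ∈ q.2 → False := fun c h1 h2 => Set.disjoint_left.1 hq h1 h2
  have hm' : ∀ c, c ∈ m → c ∈ cp₃ τ q ∧ c ∉ cp₁ τ q := fun c hc => hm hc
  simp only [mem_cp₁_iff, mem_cp₃_iff] at hm'
  refine ⟨?_, rfl, ?_, ?_⟩
  · ext c
    simp only [mvL, mem_cp₁_iff, Set.mem_symmDiff, Set.mem_union]
    have := hm' c; tauto
  · ext c
    simp only [mvL, mem_cp₃_iff, Set.mem_symmDiff, Set.mem_sdiff]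
    have := hm' c; have := hd c; tauto
  · refine Set.disjoint_left.2 fun c h1 h2 => ?_
    simp only [mvL, Set.mem_symmDiff] at h1 h2
    have := hm' c; have := hd c; tauto

/-- **Copies after a `K`-move** of `m ⊆ x₂ ∖ x₁` from copy 2 to copy 1. [this work] -/
theorem cp_mvK (τ : Set ι) {q : Set ι × Set ι} (hq : Disjoint q.1 q.2) {m : Set ι} (hm : m ⊆ cp₂ τ q \ cp₁ τ q) :
    cp₁ τ (mvK q m) = cp₁ τ q ∪ m ∧ cp₂ τ (mvK q m) = cp₂ τ q \ m ∧ cp₃ τ (mvK q m) = cp₃ τ q ∧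
      Disjoint (mvK q m).1 (mvK q m).2 := by
  have hd : ∀ c, c ∈ q.1 → c ∈ q.2 → False := fun c h1 h2 => Set.disjoint_left.1 hq h1 h2
  have hm' : ∀ c, c ∈ m → c ∈ cp₂ τ q ∧ c ∉ cp₁ τ q := fun c hc => hm hc
  simp only [mem_cp₁_iff, mem_cp₂_iff] at hm'
  refine ⟨?_, ?_, ?_, ?_⟩
  · ext c
    simp only [mvK, mem_cp₁_iff, Set.mem_symmDiff, Set.mem_union]
    have := hm' c; tauto
  · ext c
    simp only [mvK, mem_cp₂_iff, Set.mem_symmDiff, Set.mem_sdiff]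
    have := hm' c; have := hd c; tauto
  · ext c
    simp only [mvK, mem_cp₃_iff, Set.mem_symmDiff]
    have := hm' c; have := hd c; tauto
  · refine Set.disjoint_left.2 fun c h1 h2 => ?_
    simp only [mvK, Set.mem_symmDiff] at h1 h2
    have := hm' c; have := hd c; tauto

/-- **Copies after an `E`-move** of `m ⊆ x₂ ∖ x₃` from copy 2 to copy 3. [this work] -/
theorem cp_mvE (τ : Set ι) {q : Set ι × Set ι} (hq : Disjoint q.1 q.2) {m : Set ι} (hm : m ⊆ cp₂ τ q \ cp₃ τ q) :
    cp₁ τ (mvE q m) = cp₁ τ q ∧ cp₂ τ (mvE q m) = cp₂ τ q \ m ∧ cp₃ τ (mvE q m) = cp₃ τ q ∪ m ∧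
      Disjoint (mvE q m).1 (mvE q m).2 := by
  have hd : ∀ c, c ∈ q.1 → c ∈ q.2 → False := fun c h1 h2 => Set.disjoint_left.1 hq h1 h2
  have hm' : ∀ c, c ∈ m → c ∈ cp₂ τ q ∧ c ∉ cp₃ τ q := fun c hc => hm hc
  simp only [mem_cp₂_iff, mem_cp₃_iff] at hm'
  refine ⟨rfl, ?_, ?_, ?_⟩
  · ext c
    simp only [mvE, mem_cp₂_iff, Set.mem_symmDiff, Set.mem_sdiff]
    have := hm' c; have := hd c; tauto
  · ext c
    simp only [mvE, mem_cp₃_iff, Set.mem_symmDiff, Set.mem_union]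
    have := hm' c; have := hd c; tauto
  · refine Set.disjoint_left.2 fun c h1 h2 => ?_
    simp only [mvE, Set.mem_symmDiff] at h1 h2
    have := hm' c; have := hd c; tauto

/-! ## Tokens and typed edges, unfolded for a general twist -/

/-- The three elements of `Fin 3`. [folklore] -/
private theorem fin3_cases_tw (i : Fin 3) : i = 0 ∨ i = 1 ∨ i = 2 := by
  fin_cases i <;> simp

variable [Fintype ι]

/-- Membership in the negative tokens, any twist. [this work] -/
theorem mem_negToks_iff {τ : Set ι} {𝒱 𝒲 : Set (Set ι)} {t : (Set ι × Set ι) × Fin 3} :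
    t ∈ negToks τ 𝒱 𝒲 ↔
      Disjoint t.1.1 t.1.2 ∧
        ((t.2 = 0 ∧ cp₁ τ t.1 ∈ 𝒱 ∧ cp₃ τ t.1 ∈ 𝒲) ∨ (t.2 = 1 ∧ cp₁ τ t.1 ∈ 𝒲 ∧ cp₂ τ t.1 ∈ 𝒱) ∨
          (t.2 = 2 ∧ cp₂ τ t.1 ∈ 𝒱 ∧ cp₂ τ t.1 ∈ 𝒲)) := by
  unfold negToks cfgs negCond
  simp only [mem_filter, mem_product, mem_univ, and_true, true_and]
  rcases fin3_cases_tw t.2 with h | h | h <;> simp [h]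

/-- Membership in the positive tokens, any twist. [this work] -/
theorem mem_posToks_iff {τ : Set ι} {𝒱 𝒲 : Set (Set ι)} {p : (Set ι × Set ι) × Fin 3} :
    p ∈ posToks τ 𝒱 𝒲 ↔
      Disjoint p.1.1 p.1.2 ∧
        ((p.2 = 0 ∧ cp₁ τ p.1 ∈ 𝒱 ∧ cp₁ τ p.1 ∈ 𝒲) ∨ (p.2 = 1 ∧ cp₁ τ p.1 ∈ 𝒱 ∧ cp₁ τ p.1 ∈ 𝒲) ∨
          (p.2 = 2 ∧ cp₂ τ p.1 ∈ 𝒱 ∧ cp₃ τ p.1 ∈ 𝒲)) := by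
  unfold posToks cfgs posCond
  simp only [mem_filter, mem_product, mem_univ, and_true, true_and]
  rcases fin3_cases_tw p.2 with h | h | h <;> simp [h]

omit [Fintype ι] in
/-- The typed edge relation in terms of the copies. [this work] -/
theorem typedEdge_iff_cp {τ : Set ι} {q q' : Set ι × Set ι} {i j : Fin 3} :
    typedEdge τ q i q' j ↔
      (cp₁ τ q ⊆ cp₁ τ q' ∧ cp₂ τ q' ⊆ cp₂ τ q) ∧
        ((i = 0 ∧ ((j = 0 ∧ cp₂ τ q' = cp₂ τ q) ∨ (j = 1 ∧ cp₃ τ q' ⊆ cp₃ τ q))) ∨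
         (i = 1 ∧ j = 1 ∧ cp₃ τ q' = cp₃ τ q) ∨
         (i = 2 ∧ ((j = 0 ∧ cp₃ τ q' = cp₃ τ q) ∨ (j = 2 ∧ cp₁ τ q' = cp₁ τ q)))) := Iff.rfl


/-! ## The twisted OR–OR matching and its decoder -/

section Map

variable (τ P Q : Set ι)

/-- **The matching for `(τ, OR P, OR Q)`** in copy coordinates (`T = P ∩ Q`, `P′ = P ∖ Q`): the case table of `ororMap` with `T ⊆ x₃ ↦ x₂ ∩ T = ∅`,
`T ⊆ x₂ ↦ x₁ ∩ T = ∅`, `Q ⊆ x₂ ↦ x₁ ∩ Q = ∅`, the moves performed by `mvL` / `mvK` / `mvE`. [this work] -/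
def ororMapT (t : (Set ι × Set ι) × Fin 3) : (Set ι × Set ι) × Fin 3 :=
  let x₁ := cp₁ τ t.1
  let x₂ := cp₂ τ t.1
  let x₃ := cp₃ τ t.1
  let T := P ∩ Q
  let P' := P \ Q
  if t.2 = 0 then
    if (x₁ ∩ Q).Nonempty then t
    else if P' ∩ x₂ = ∅ ∧ (P' ∩ x₁).Nonempty ∧ (x₂ ∩ T).Nonempty then (mvK t.1 (x₂ ∩ T), 1)
    else if P' ∩ x₂ = ∅ ∧ (P' ∩ x₁).Nonempty ∧ x₃ ∩ Q = T then (mvL t.1 T, 1)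
    else (mvL t.1 (x₃ ∩ Q), 0)
  else if t.2 = 1 then
    if (x₁ ∩ P).Nonempty then t else (mvK t.1 (x₂ ∩ P), 1)
  else
    if (x₃ ∩ Q).Nonempty then t
    else if (x₂ ∩ P').Nonempty ∧ ((P' ∩ x₁).Nonempty ∨ (x₁ ∩ T = ∅ ∧ x₂ ∩ Q ≠ T)) then (mvE t.1 (x₂ ∩ Q), 2)
    else if x₁ ∩ T = ∅ ∧ ((¬ (x₂ ∩ P').Nonempty ∧ (P' ∩ x₁ = ∅ ∨ x₁ ∩ Q = ∅)) ∨
        ((x₂ ∩ P').Nonempty ∧ P' ∩ x₁ = ∅ ∧ x₂ ∩ Q = T)) then (mvK t.1 T, 0)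
    else (t.1, 0)

/-- **The decoder** (left inverse of `ororMapT` on the negative tokens). [this work] -/
def ororInvT (p : (Set ι × Set ι) × Fin 3) : (Set ι × Set ι) × Fin 3 :=
  let y₁ := cp₁ τ p.1
  let y₂ := cp₂ τ p.1
  let y₃ := cp₃ τ p.1
  let T := P ∩ Q
  let P' := P \ Q
  if p.2 = 0 then
    if (y₃ ∩ Q).Nonempty then p
    else if (y₁ ∩ P').Nonempty ∧ ((y₂ ∩ P').Nonempty ∨ (y₂ ∩ T = ∅ ∧ y₁ ∩ Q ≠ T)) then (mvL p.1 (y₁ ∩ Q), 0)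
    else if (y₂ ∩ P).Nonempty ∧ (y₂ ∩ Q).Nonempty then (p.1, 2)
    else (mvK p.1 T, 2)
  else if p.2 = 1 then
    if (y₂ ∩ P).Nonempty then p
    else if (y₁ ∩ (Q \ P)).Nonempty then (mvK p.1 (y₁ ∩ P), 1)
    else if (y₃ ∩ Q).Nonempty then (mvK p.1 (y₁ ∩ T), 0)
    else (mvL p.1 T, 0)
  else
    if (y₂ ∩ Q).Nonempty then p else (mvE p.1 (y₃ ∩ Q), 2)

end Map

/-! ## Forward: negative tokens go to positive tokens along typed edges -/

/-- `1 ≠ 0` in `Fin 3`. [folklore] -/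
private theorem fin10' : ¬ ((1 : Fin 3) = 0) := by decide
/-- `2 ≠ 0` in `Fin 3`. [folklore] -/
private theorem fin20' : ¬ ((2 : Fin 3) = 0) := by decide
/-- `2 ≠ 1` in `Fin 3`. [folklore] -/
private theorem fin21' : ¬ ((2 : Fin 3) = 1) := by decide

/-- **Forward spec** of the twisted OR–OR matching. [this work] -/
theorem ororMapT_spec (τ P Q : Set ι) {t : (Set ι × Set ι) × Fin 3} (ht : t ∈ negToks τ (orFam P) (orFam Q)) :
    ororMapT τ P Q t ∈ posToks τ (orFam P) (orFam Q) ∧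
      typedEdge τ t.1 t.2 (ororMapT τ P Q t).1 (ororMapT τ P Q t).2 := by
  obtain ⟨q, i⟩ := t
  rw [mem_negToks_iff] at ht
  obtain ⟨hdis, hk⟩ := ht
  dsimp only at hdis hk ⊢
  -- names for the copies
  set x₁ := cp₁ τ q with hx₁
  set x₂ := cp₂ τ q with hx₂
  set x₃ := cp₃ τ q with hx₃
  have hcov : ∀ c, c ∈ x₁ ∨ c ∈ x₂ ∨ c ∈ x₃ := mem_cp_cover τ q
  rcases hk with ⟨rfl, hV, hW⟩ | ⟨rfl, hW1, hV2⟩ | ⟨rfl, hP2, hQ2⟩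
  · -- N1 tokens: `x₁ ∈ V`, `x₃ ∈ W`
    rw [mem_orFam] at hV hW
    simp only [ororMapT, if_true]
    split_ifs with h1 h2 h3
    · exact ⟨mem_posToks_iff.2 ⟨hdis, Or.inl ⟨rfl, hV, h1⟩⟩,
        typedEdge_iff_cp.2 ⟨⟨subset_rfl, subset_rfl⟩, Or.inl ⟨rfl, Or.inl ⟨rfl, rfl⟩⟩⟩⟩
    · -- diversion 1: `K`-move of `x₂ ∩ T`
      obtain ⟨_, ⟨b, hb⟩, ⟨a, ha⟩⟩ := h2
      have hm : x₂ ∩ (P ∩ Q) ⊆ cp₂ τ q \ cp₁ τ q := fun c hc => ⟨hc.1, fun hc1 => h1 ⟨c, hc1, hc.2.2⟩⟩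
      obtain ⟨e1, e2, e3, hd'⟩ := cp_mvK τ hdis hm
      refine ⟨mem_posToks_iff.2 ⟨hd', Or.inr (Or.inl ⟨rfl, ?_, ?_⟩)⟩, typedEdge_iff_cp.2 ⟨⟨?_, ?_⟩, Or.inl ⟨rfl, Or.inr ⟨rfl, ?_⟩⟩⟩⟩
      · rw [e1, mem_orFam]; exact ⟨b, Or.inl hb.2, hb.1.1⟩
      · rw [e1, mem_orFam]; exact ⟨a, Or.inr ha, ha.2.2⟩
      · rw [e1]; exact Set.subset_union_left
      · rw [e2]; exact Set.sdiff_subset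
      · rw [e3]
    · -- diversion 2: `L`-move of `T`
      obtain ⟨_, ⟨b, hb⟩, h3c⟩ := h3
      have hm : P ∩ Q ⊆ cp₃ τ q \ cp₁ τ q := fun c hc =>
        ⟨by have : c ∈ x₃ ∩ Q := by rw [h3c]; exact hc
            exact this.1, fun hc1 => h1 ⟨c, hc1, hc.2⟩⟩
      obtain ⟨e1, e2, e3, hd'⟩ := cp_mvL τ hdis hm
      obtain ⟨a, ha⟩ := hW
      have haT : a ∈ P ∩ Q := by rw [← h3c]; exact ha
      refine ⟨mem_posToks_iff.2 ⟨hd', Or.inr (Or.inl ⟨rfl, ?_, ?_⟩)⟩, typedEdge_iff_cp.2 ⟨⟨?_, ?_⟩, Or.inl ⟨rfl, Or.inr ⟨rfl, ?_⟩⟩⟩⟩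
      · rw [e1, mem_orFam]; exact ⟨b, Or.inl hb.2, hb.1.1⟩
      · rw [e1, mem_orFam]; exact ⟨a, Or.inr haT, haT.2⟩
      · rw [e1]; exact Set.subset_union_left
      · rw [e2]
      · rw [e3]; exact Set.sdiff_subset
    · -- canonical landing: `L`-move of `x₃ ∩ Q`
      have hm : x₃ ∩ Q ⊆ cp₃ τ q \ cp₁ τ q := fun c hc => ⟨hc.1, fun hc1 => h1 ⟨c, hc1, hc.2⟩⟩
      obtain ⟨e1, e2, e3, hd'⟩ := cp_mvL τ hdis hm
      obtain ⟨a, ha⟩ := hW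
      obtain ⟨b, hb⟩ := hV
      refine ⟨mem_posToks_iff.2 ⟨hd', Or.inl ⟨rfl, ?_, ?_⟩⟩, typedEdge_iff_cp.2 ⟨⟨?_, ?_⟩, Or.inl ⟨rfl, Or.inl ⟨rfl, ?_⟩⟩⟩⟩
      · rw [e1, mem_orFam]; exact ⟨b, Or.inl hb.1, hb.2⟩
      · rw [e1, mem_orFam]; exact ⟨a, Or.inr ha, ha.2⟩
      · rw [e1]; exact Set.subset_union_left
      · rw [e2]
      · rw [e2]
  · -- N2 tokens: `x₁ ∈ W`, `x₂ ∈ V`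
    rw [mem_orFam] at hW1 hV2
    simp only [ororMapT, fin10', if_false, if_true]
    split_ifs with h1
    · exact ⟨mem_posToks_iff.2 ⟨hdis, Or.inr (Or.inl ⟨rfl, h1, hW1⟩)⟩,
        typedEdge_iff_cp.2 ⟨⟨subset_rfl, subset_rfl⟩, Or.inr (Or.inl ⟨rfl, rfl, rfl⟩)⟩⟩
    · have hm : x₂ ∩ P ⊆ cp₂ τ q \ cp₁ τ q := fun c hc => ⟨hc.1, fun hc1 => h1 ⟨c, hc1, hc.2⟩⟩
      obtain ⟨e1, e2, e3, hd'⟩ := cp_mvK τ hdis hm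
      obtain ⟨b, hb⟩ := hV2
      obtain ⟨a, ha⟩ := hW1
      refine ⟨mem_posToks_iff.2 ⟨hd', Or.inr (Or.inl ⟨rfl, ?_, ?_⟩)⟩, typedEdge_iff_cp.2 ⟨⟨?_, ?_⟩, Or.inr (Or.inl ⟨rfl, rfl, ?_⟩)⟩⟩
      · rw [e1, mem_orFam]; exact ⟨b, Or.inr hb, hb.2⟩
      · rw [e1, mem_orFam]; exact ⟨a, Or.inl ha.1, ha.2⟩
      · rw [e1]; exact Set.subset_union_left
      · rw [e2]; exact Set.sdiff_subset
      · rw [e3]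
  · -- N3 tokens: `x₂ ∈ V ∩ W`
    rw [mem_orFam] at hP2 hQ2
    simp only [ororMapT, fin20', fin21', if_false]
    split_ifs with h1 h2 h3
    · -- `x₃ ∈ W`: own `T₂`
      exact ⟨mem_posToks_iff.2 ⟨hdis, Or.inr (Or.inr ⟨rfl, mem_orFam.2 hP2, h1⟩)⟩,
        typedEdge_iff_cp.2 ⟨⟨subset_rfl, subset_rfl⟩, Or.inr (Or.inr ⟨rfl, Or.inr ⟨rfl, rfl⟩⟩)⟩⟩
    · -- exit: `E`-move of `x₂ ∩ Q`
      obtain ⟨⟨b, hb⟩, _⟩ := h2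
      have hm : x₂ ∩ Q ⊆ cp₂ τ q \ cp₃ τ q := fun c hc => ⟨hc.1, fun hc3 => h1 ⟨c, hc3, hc.2⟩⟩
      obtain ⟨e1, e2, e3, hd'⟩ := cp_mvE τ hdis hm
      obtain ⟨a, ha⟩ := hQ2
      refine ⟨mem_posToks_iff.2 ⟨hd', Or.inr (Or.inr ⟨rfl, ?_, ?_⟩)⟩, typedEdge_iff_cp.2 ⟨⟨?_, ?_⟩, Or.inr (Or.inr ⟨rfl, Or.inr ⟨rfl, ?_⟩⟩)⟩⟩
      · rw [e2, mem_orFam]; exact ⟨b, ⟨hb.1, fun h => hb.2.2 h.2⟩, hb.2.1⟩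
      · rw [e3, mem_orFam]; exact ⟨a, Or.inr ha, ha.2⟩
      · rw [e1]
      · rw [e2]; exact Set.sdiff_subset
      · rw [e1]
    · -- shift: `K`-move of `T`
      obtain ⟨hT1, hrest⟩ := h3
      have hm : P ∩ Q ⊆ cp₂ τ q \ cp₁ τ q := fun c hc => by
        have hc1 : c ∉ x₁ := fun hc1 => by
          have : c ∈ x₁ ∩ (P ∩ Q) := ⟨hc1, hc⟩
          rw [hT1] at this; exact this
        refine ⟨?_, hc1⟩
        rcases hcov c with h | h | h
        · exact absurd h hc1
        · exact h
        · exact absurd ⟨c, h, hc.2⟩ h1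
      obtain ⟨e1, e2, e3, hd'⟩ := cp_mvK τ hdis hm
      have hT : ∃ a, a ∈ P ∩ Q := by
        rcases hrest with ⟨hL, _⟩ | ⟨_, _, hQT⟩
        · obtain ⟨a, ha⟩ := hP2
          by_cases haQ : a ∈ Q
          · exact ⟨a, ha.2, haQ⟩
          · exact absurd ⟨a, ha.1, ha.2, haQ⟩ hL
        · obtain ⟨a, ha⟩ := hQ2
          exact ⟨a, by rw [← hQT]; exact ha⟩
      obtain ⟨a, ha⟩ := hT
      refine ⟨mem_posToks_iff.2 ⟨hd', Or.inl ⟨rfl, ?_, ?_⟩⟩, typedEdge_iff_cp.2 ⟨⟨?_, ?_⟩, Or.inr (Or.inr ⟨rfl, Or.inl ⟨rfl, ?_⟩⟩)⟩⟩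
      · rw [e1, mem_orFam]; exact ⟨a, Or.inr ha, ha.1⟩
      · rw [e1, mem_orFam]; exact ⟨a, Or.inr ha, ha.2⟩
      · rw [e1]; exact Set.subset_union_left
      · rw [e2]; exact Set.sdiff_subset
      · rw [e3]
    · -- own unit a: `x₁ ∈ V ∩ W`
      have key : (x₁ ∩ P).Nonempty ∧ (x₁ ∩ Q).Nonempty := by
        by_cases hT1 : x₁ ∩ (P ∩ Q) = ∅
        · by_cases hL : (x₂ ∩ (P \ Q)).Nonempty
          · exfalso
            have hA1 : ¬ (P \ Q ∩ x₁).Nonempty := fun hA1 => h2 ⟨hL, Or.inl hA1⟩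
            have hQT : x₂ ∩ Q = P ∩ Q := by
              by_contra hne
              exact h2 ⟨hL, Or.inr ⟨hT1, hne⟩⟩
            exact h3 ⟨hT1, Or.inr ⟨hL, Set.not_nonempty_iff_eq_empty.1 hA1, hQT⟩⟩
          · have hA1 : (P \ Q ∩ x₁).Nonempty := by
              by_contra hA1
              exact h3 ⟨hT1, Or.inl ⟨hL, Or.inl (Set.not_nonempty_iff_eq_empty.1 hA1)⟩⟩
            have hQ1 : (x₁ ∩ Q).Nonempty := by
              by_contra hQ1
              exact h3 ⟨hT1, Or.inl ⟨hL, Or.inr (Set.not_nonempty_iff_eq_empty.1 hQ1)⟩⟩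
            obtain ⟨b, hb⟩ := hA1
            exact ⟨⟨b, hb.2, hb.1.1⟩, hQ1⟩
        · obtain ⟨a, ha⟩ := Set.nonempty_iff_ne_empty.2 hT1
          exact ⟨⟨a, ha.1, ha.2.1⟩, ⟨a, ha.1, ha.2.2⟩⟩
      exact ⟨mem_posToks_iff.2 ⟨hdis, Or.inl ⟨rfl, mem_orFam.2 key.1, mem_orFam.2 key.2⟩⟩,
        typedEdge_iff_cp.2 ⟨⟨subset_rfl, subset_rfl⟩, Or.inr (Or.inr ⟨rfl, Or.inl ⟨rfl, rfl⟩⟩)⟩⟩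

end Summit.CriticalPhenomena.PercolationContinuityZ3.Theorems.ThreePartition

end
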